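import Summits.BirchSwinnertonDyer.BirchSwinnertonDyer.Theorems.BiquadraticEisensteinDescentHeegnerTwistCouplingInSupplySqrtSevenRungsHecke
import Literature.NumberTheory.EllipticCurves.X049GroupOrderHoldsProofs
import HarnessLib

set_option linter.dupNamespace false -- `Summit.BirchSwinnertonDyer.BirchSwinnertonDyer.Theorems.…` (summit = sub)
set_option autoImplicit false

/-!
# Crux `HeegnerTwistCouplingInSupply` (stmt-BirchSwinnertonDyer-21381) — the `j = −3375` corner and rungs with NO printed input left but
# Burungale–Tian: the group order formula of `X₀(49)` is now a theorem of the tree (`X049.groupOrder_A7_holds`)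

Sequel to `…SqrtSevenCornerHecke` / `…SqrtSevenRungsHecke` (this seat), which replaced the Deuring–Hecke binder `hH` of w1 g11's corner
(`…SqrtSevenCorner.cruxOnSqrtSevenCorner_of_two_facts`) and rungs (`…SqrtSevenRungs.rung*_of_two_facts`) by the ONE printed sign rule
`X049.groupOrder_A7` («`#E(𝔽_p) = p + 1 − (2u/7)·u` whenever `p ≠ 7`, `4p = u² + 7v²`», `E = 49a1 = X₀(49)`; Silverberg 2010 (2.1) = Rajwade 1977
Thm. 3), Hecke's continuation for the class `j = −3375` being a kernel theorem (`X049.hasEntireLFunction_of_j_eq_neg3375`, theta series of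
`ℤ[½(1+√−7)]`).  That sign rule is now PROVED in the tree — `Literature.NumberTheory.EllipticCurves.X049.groupOrder_A7_holds`
(`X049GroupOrderHoldsProofs`: the formula up to sign from Deuring, `X049GroupOrderUpToSign.groupOrder_A7_iff_sign`, and the sign
`a_p ≡ p² + p⁵ (mod 7)` by the `√−7`-torsion Frobenius argument on the explicit kernel of the `7`-isogeny over `ℚ(ζ₇)`, `X049SevenTorsionFrobenius`) —
so the corner and the rungs hold modulo Burungale–Tian ALONE.  This file records exactly that (one-line specialisations, no new mathematics):

* `hasEntireLFunction_A`, `L_one_ne_zero_A_of_BT` — the cell lemmas (`L(A_n, s)` entire, unconditionally; `r_an(A_n) = 0 ∧ L(A_n, 1) ≠ 0` mod BT);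
* ★★★ `cruxOnSqrtSevenCorner_of_BT` — for EVERY prime `p ≡ 3 (mod 8)`, `p ≡ 3, 5, 6 (mod 7)` and `W = W_p = [1, −(21p+1)/4, 0, 7p², 0]`: a field `K′`
  with `4 < |d_{K′}|`, Heegner for `N(W_p)`, `L(W_p^{(d_{K′})}, 1) ≠ 0`, `h(K′) < p`, `p ∤ h(K′)` — modulo Burungale–Tian alone;
  `cruxOnSqrtSevenCorner_of_BT'` (consequent shape); ★★ `heegnerTwistCouplingInSupply_on_W_of_BT` — crux 21381 VERBATIM on `W = W_p`, modulo BT alone;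
* `rung_of_BT` (generic pin-free rung on `W⁻_p = X₀(49)^{(−p)}`, `p ≡ 1 (mod 4)`) and the eight rungs `rung255_of_BT`, …, `rung1615_of_BT`, modulo BT alone.

HONEST FRAMING: one CM family (`j = −3375`); crux 21381 (all CM `W`, all inert `p ≥ 5`) is NOT closed — the `p ≡ 7 (mod 8)` quarter of this
corner and `C⁺` (`stub_nonNullIndivisibleHeegner`) are untouched; Burungale–Tian (`burungaleTian_analyticRank_eq_zero_of_selmerCorank_eq_zero_of_hasCM`)
stays a named fact; the Birch–Swinnerton-Dyer conjecture is not proved by any of this.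

## References
* A. Burungale, Y. Tian, Thm. 1.1. [BurungaleTian2026]
* A. Silverberg, Contemp. Math. 521 (2010), (2.1) and Table 1. [Silverberg2010]
* A. R. Rajwade, J. Austral. Math. Soc. A 24 (1977), Thm. 3, Thm. 4. [Rajwade1977]
* D. A. Cox, *Primes of the form x² + ny²*, 2nd ed. (2013), §2.A Thm. 2.13, §7.B Thm. 7.7(ii). [Cox2013]
-/

noncomputable section

open scoped Classical NumberField NumberTheorySymbols

namespace Summit.BirchSwinnertonDyer.BirchSwinnertonDyer.Theorems.BiquadraticEisensteinDescentHeegnerTwistCouplingInSupplySqrtSevenCornerBT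

open _root_.WeierstrassCurve Literature.NumberTheory.EllipticCurves Literature.NumberTheory Literature.NumberTheory.Automorphic
open Literature.NumberTheory.EllipticCurves.Rank1Residual
open Literature.NumberTheory.QuadraticFields Literature.NumberTheory.QuadraticFields.Quadratic
open IsDedekindDomain Rat.HeightOneSpectrum
open Summit.BirchSwinnertonDyer.BirchSwinnertonDyer.Theorems.BiquadraticEisensteinDescentHeegnerTwistCouplingInSupplySqrtSevenCell
open Summit.BirchSwinnertonDyer.BirchSwinnertonDyer.Theorems.BiquadraticEisensteinDescentHeegnerTwistCouplingInSupplySqrtSevenCorner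
open Summit.BirchSwinnertonDyer.BirchSwinnertonDyer.Theorems.BiquadraticEisensteinDescentHeegnerTwistCouplingInSupplySqrtSevenCornerInstance
open Summit.BirchSwinnertonDyer.BirchSwinnertonDyer.Theorems.BiquadraticEisensteinDescentHeegnerTwistCouplingInSupplySqrtSevenCornerHecke
open Summit.BirchSwinnertonDyer.BirchSwinnertonDyer.Theorems.BiquadraticEisensteinDescentHeegnerTwistCouplingInSupplySqrtSevenRungsHecke

/-! ## §1 The cell lemmas, unconditionally / modulo Burungale–Tian alone -/

/-- **`L(A_n, s)` is entire**, `A_n : y² = x(x² + 21nx + 112n²)` (`n ≠ 0`, `j(A_n) = −3375`) — UNCONDITIONALLY (`X049.hasEntireLFunction_of_j_eq_neg3375_holds`).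
[cite: Rajwade1977, Thm 4 and Thm 6] [cite: Silverberg2010, (2.1)] -/
theorem hasEntireLFunction_A {n : ℕ} (hn : n ≠ 0) [(⟨0, 21 * (n : ℚ), 0, 112 * (n : ℚ) ^ 2, 0⟩ : WeierstrassCurve ℚ).IsElliptic] :
    (⟨0, 21 * (n : ℚ), 0, 112 * (n : ℚ) ^ 2, 0⟩ : WeierstrassCurve ℚ).HasEntireLFunction :=
  hasEntireLFunction_A_of_groupOrder X049.groupOrder_A7_holds hn

variable {q m : ℕ} in
/-- ★ **CELL-√7, `L`-form, modulo Burungale–Tian alone**: `r_an(A_n) = 0` and `L(A_n, 1) ≠ 0` for `n = qm` in the cell (`q ≡ 3 (mod 8)` prime,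
`q ≡ 3, 5, 6 (mod 7)`, `m` square-free with all prime factors `≡ 1 (mod 4)` and `≡ 3, 5, 6 (mod 7)`, `q ∤ m`). [cite: BurungaleTian2026, Thm. 1.1] -/
theorem L_one_ne_zero_A_of_BT (hBT : burungaleTian_analyticRank_eq_zero_of_selmerCorank_eq_zero_of_hasCM)
    (hq : q.Prime) (hq8 : q % 8 = 3) (hq7 : q % 7 = 3 ∨ q % 7 = 5 ∨ q % 7 = 6) (hm0 : 0 < m) (hmsq : Squarefree m) (hqm : ¬ q ∣ m)
    (hm : ∀ r : ℕ, r.Prime → r ∣ m → r % 4 = 1 ∧ (r % 7 = 3 ∨ r % 7 = 5 ∨ r % 7 = 6))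
    [(⟨0, 21 * ((q * m : ℕ) : ℚ), 0, 112 * ((q * m : ℕ) : ℚ) ^ 2, 0⟩ : WeierstrassCurve ℚ).IsElliptic] :
    (⟨0, 21 * ((q * m : ℕ) : ℚ), 0, 112 * ((q * m : ℕ) : ℚ) ^ 2, 0⟩ : WeierstrassCurve ℚ).analyticRank = 0 ∧
      (⟨0, 21 * ((q * m : ℕ) : ℚ), 0, 112 * ((q * m : ℕ) : ℚ) ^ 2, 0⟩ : WeierstrassCurve ℚ).entireLFunction 1 ≠ 0 :=
  L_one_ne_zero_A_of_groupOrder hBT X049.groupOrder_A7_holds hq hq8 hq7 hm0 hmsq hqm hm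

/-! ## §2 ★★★ The `p ≡ 3 (mod 8)` corner of crux 21381 on `W = W_p`, modulo Burungale–Tian ALONE -/

/-- ★★★ **The corner, modulo Burungale–Tian alone**: for EVERY prime `p` with `p ≡ 3 (mod 8)` and `p ≡ 3, 5, 6 (mod 7)` and the curve
`W_p = [1, −(21p+1)/4, 0, 7p², 0]` (`j = −3375`, CM by `ℤ[½(1+√−7)]`, conductor `49p²`, root number `−1`, `p` inert in `ℚ(√−7)`), there is an
imaginary quadratic field `K′` with `4 < |d_{K′}|`, Heegner for `N(W_p)`, `L(W_p^{(d_{K′})}, 1) ≠ 0`, `h(K′) < p` and `p ∤ h(K′)` — w1 g11's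
`cruxOnSqrtSevenCorner_of_two_facts` with its second fact (Deuring–Hecke continuation) now a kernel theorem (`X049.hasEntireLFunction_of_j_eq_neg3375_holds`).
[cite: BurungaleTian2026, Thm. 1.1] [cite: Silverberg2010, (2.1)] [cite: Rajwade1977, Thm 3 and Thm 4] -/
theorem cruxOnSqrtSevenCorner_of_BT (hBT : burungaleTian_analyticRank_eq_zero_of_selmerCorank_eq_zero_of_hasCM) :
    ∀ (p : ℕ) [Fact p.Prime], 5 ≤ p → p % 8 = 3 → (p % 7 = 3 ∨ p % 7 = 5 ∨ p % 7 = 6) →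
      ∃ (K : Type) (_ : Field K) (_ : NumberField K),
        IsImaginaryQuadratic K ∧ 4 < (NumberField.discr K).natAbs ∧
        SatisfiesHeegnerHypothesis ((⟨1, -(((21 * p + 1) / 4 : ℕ) : ℚ), 0, 7 * (p : ℚ) ^ 2, 0⟩ : WeierstrassCurve ℚ).conductorNorm ℤ) K ∧
        ((⟨1, -(((21 * p + 1) / 4 : ℕ) : ℚ), 0, 7 * (p : ℚ) ^ 2, 0⟩ : WeierstrassCurve ℚ).quadraticTwist
          (NumberField.discr K : ℚ)).entireLFunction 1 ≠ 0 ∧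
        NumberField.classNumber K < p ∧ ¬ p ∣ NumberField.classNumber K :=
  cruxOnSqrtSevenCorner_of_BT_of_groupOrder hBT X049.groupOrder_A7_holds

/-- The corner in the shape of crux 21381's consequent (dropping `h(K′) < p`), modulo Burungale–Tian alone. [cite: BurungaleTian2026, Thm. 1.1] -/
theorem cruxOnSqrtSevenCorner_of_BT' (hBT : burungaleTian_analyticRank_eq_zero_of_selmerCorank_eq_zero_of_hasCM)
    {p : ℕ} [Fact p.Prime] (hp5 : 5 ≤ p) (hp8 : p % 8 = 3) (hp7 : p % 7 = 3 ∨ p % 7 = 5 ∨ p % 7 = 6) :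
    ∃ (K : Type) (_ : Field K) (_ : NumberField K), IsImaginaryQuadratic K ∧ 4 < (NumberField.discr K).natAbs ∧
      SatisfiesHeegnerHypothesis ((⟨1, -(((21 * p + 1) / 4 : ℕ) : ℚ), 0, 7 * (p : ℚ) ^ 2, 0⟩ : WeierstrassCurve ℚ).conductorNorm ℤ) K ∧
      ((⟨1, -(((21 * p + 1) / 4 : ℕ) : ℚ), 0, 7 * (p : ℚ) ^ 2, 0⟩ : WeierstrassCurve ℚ).quadraticTwist
        (NumberField.discr K : ℚ)).entireLFunction 1 ≠ 0 ∧
      ¬ p ∣ NumberField.classNumber K :=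
  cruxOnSqrtSevenCorner_of_groupOrder hBT X049.groupOrder_A7_holds hp5 hp8 hp7

/-- ★★ **Crux 21381 VERBATIM on `W = W_p`** (`p ≡ 3 (mod 8)`, `p ≡ 3, 5, 6 (mod 7)`), modulo Burungale–Tian ALONE: the implication
`HeegnerTwistCouplingInSupply` with all its binders and hypotheses holds for this `W` and `p`.  The crux itself (ALL CM `W`) is not closed by this;
BSD is not proved by this. [cite: BurungaleTian2026, Thm. 1.1] -/
theorem heegnerTwistCouplingInSupply_on_W_of_BT (hBT : burungaleTian_analyticRank_eq_zero_of_selmerCorank_eq_zero_of_hasCM)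
    {p : ℕ} (hp8 : p % 8 = 3) (hp7 : p % 7 = 3 ∨ p % 7 = 5 ∨ p % 7 = 6)
    [Fact p.Prime] [(⟨1, -(((21 * p + 1) / 4 : ℕ) : ℚ), 0, 7 * (p : ℚ) ^ 2, 0⟩ : WeierstrassCurve ℚ).IsElliptic]
    [(⟨1, -(((21 * p + 1) / 4 : ℕ) : ℚ), 0, 7 * (p : ℚ) ^ 2, 0⟩ : WeierstrassCurve ℚ).IsGloballyMinimal]
    [NeZero ((⟨1, -(((21 * p + 1) / 4 : ℕ) : ℚ), 0, 7 * (p : ℚ) ^ 2, 0⟩ : WeierstrassCurve ℚ).conductorNorm ℤ)] :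
    (⟨1, -(((21 * p + 1) / 4 : ℕ) : ℚ), 0, 7 * (p : ℚ) ^ 2, 0⟩ : WeierstrassCurve ℚ).HasCM →
    (⟨1, -(((21 * p + 1) / 4 : ℕ) : ℚ), 0, 7 * (p : ℚ) ^ 2, 0⟩ : WeierstrassCurve ℚ).analyticRank = 1 → 5 ≤ p →
    CMInert (⟨1, -(((21 * p + 1) / 4 : ℕ) : ℚ), 0, 7 * (p : ℚ) ^ 2, 0⟩ : WeierstrassCurve ℚ) p →
    ¬ Good (⟨1, -(((21 * p + 1) / 4 : ℕ) : ℚ), 0, 7 * (p : ℚ) ^ 2, 0⟩ : WeierstrassCurve ℚ) p →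
    (∀ B : ℕ, ∃ (K : Type) (_ : Field K) (_ : NumberField K), IsImaginaryQuadratic K ∧ B < (NumberField.discr K).natAbs ∧
      4 < (NumberField.discr K).natAbs ∧
      SatisfiesHeegnerHypothesis ((⟨1, -(((21 * p + 1) / 4 : ℕ) : ℚ), 0, 7 * (p : ℚ) ^ 2, 0⟩ : WeierstrassCurve ℚ).conductorNorm ℤ) K ∧
      ¬ p ∣ NumberField.classNumber K) →
    ∃ (K : Type) (_ : Field K) (_ : NumberField K), IsImaginaryQuadratic K ∧ 4 < (NumberField.discr K).natAbs ∧
      SatisfiesHeegnerHypothesis ((⟨1, -(((21 * p + 1) / 4 : ℕ) : ℚ), 0, 7 * (p : ℚ) ^ 2, 0⟩ : WeierstrassCurve ℚ).conductorNorm ℤ) K ∧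
      ((⟨1, -(((21 * p + 1) / 4 : ℕ) : ℚ), 0, 7 * (p : ℚ) ^ 2, 0⟩ : WeierstrassCurve ℚ).quadraticTwist
        (NumberField.discr K : ℚ)).entireLFunction 1 ≠ 0 ∧
      ¬ p ∣ NumberField.classNumber K :=
  heegnerTwistCouplingInSupply_on_W_of_BT_of_groupOrder hBT X049.groupOrder_A7_holds hp8 hp7

/-! ## §3 The `p ≡ 1 (mod 4)` rungs on `W⁻_p = X₀(49)^{(−p)}`, modulo Burungale–Tian ALONE -/

/-- ★ **Generic pin-free rung, modulo Burungale–Tian alone** (`…SqrtSevenRungsHecke.rung_of_BT_of_groupOrder` with the group order formula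
discharged): primes `q₃ ≡ 3 (mod 8)`, `q₅, q₁ ≡ 1 (mod 4)`, all `≡ 3, 5, 6 (mod 7)`, `m = q₃q₅q₁ ≡ 7 (mod 8)`, `(−m/7) = 1`, `h(−m) = h₀`; then for
every prime `p ≡ 1 (mod 4)`, `(p/7) = −1`, `(−m/p) = +1`, `h₀ < p`: the conclusion of crux 21381 for `W⁻_p` with `K′ = ℚ(√−m)`.
[cite: BurungaleTian2026, Thm. 1.1] [cite: Cox2013, §2.A Thm. 2.13 and §7.B Thm. 7.7(ii)] -/
theorem rung_of_BT (hBT : burungaleTian_analyticRank_eq_zero_of_selmerCorank_eq_zero_of_hasCM)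
    {q₃ q₅ q₁ m h₀ : ℕ} (hm : m = q₃ * q₅ * q₁) (hq₃ : q₃.Prime) (hq₅ : q₅.Prime)
    (hq₁ : q₁.Prime) (hq₃8 : q₃ % 8 = 3) (hq₅4 : q₅ % 4 = 1) (hq₁4 : q₁ % 4 = 1) (h8 : m % 8 = 7)
    (hq₃7 : q₃ % 7 = 3 ∨ q₃ % 7 = 5 ∨ q₃ % 7 = 6) (hq₅7 : q₅ % 7 = 3 ∨ q₅ % 7 = 5 ∨ q₅ % 7 = 6) (hq₁7 : q₁ % 7 = 3 ∨ q₁ % 7 = 5 ∨ q₁ % 7 = 6)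
    (hne : q₅ ≠ q₁) (hJ7 : jacobiSym (-(m : ℤ)) 7 = 1) (hh : BinQF.classNumber (-(m : ℤ)) = h₀) :
    ∀ (p : ℕ) [Fact p.Prime], p % 4 = 1 → (p % 7 = 3 ∨ p % 7 = 5 ∨ p % 7 = 6) → jacobiSym (-(m : ℤ)) p = 1 → h₀ < p →
      ∃ (K : Type) (_ : Field K) (_ : NumberField K),
        IsImaginaryQuadratic K ∧ 4 < (NumberField.discr K).natAbs ∧
        SatisfiesHeegnerHypothesis ((⟨0, -21 * (p : ℚ), 0, 112 * (p : ℚ) ^ 2, 0⟩ : WeierstrassCurve ℚ).conductorNorm ℤ) K ∧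
        ((⟨0, -21 * (p : ℚ), 0, 112 * (p : ℚ) ^ 2, 0⟩ : WeierstrassCurve ℚ).quadraticTwist (NumberField.discr K : ℚ)).entireLFunction 1 ≠ 0 ∧
        NumberField.classNumber K < p ∧ ¬ p ∣ NumberField.classNumber K :=
  rung_of_BT_of_groupOrder hBT X049.groupOrder_A7_holds hm hq₃ hq₅ hq₁ hq₃8 hq₅4 hq₁4 h8 hq₃7 hq₅7 hq₁7 hne hJ7 hh

/-- ★★ **Rung `255 = 3·5·17`** (`K′ = ℚ(√−255)`, `h = 12`), modulo Burungale–Tian ALONE: for every prime `p ≡ 1 (mod 4)`, `p ≡ 3, 5, 6 (mod 7)`,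
`(−255/p) = +1`, `p > 12`, the conclusion of crux 21381 for `W = X₀(49)^{(−p)} = ⟨0, −21p, 0, 112p², 0⟩`. [cite: BurungaleTian2026, Thm. 1.1] -/
theorem rung255_of_BT (hBT : burungaleTian_analyticRank_eq_zero_of_selmerCorank_eq_zero_of_hasCM) :
    ∀ (p : ℕ) [Fact p.Prime], p % 4 = 1 → (p % 7 = 3 ∨ p % 7 = 5 ∨ p % 7 = 6) → jacobiSym (-255) p = 1 → 12 < p →
      ∃ (K : Type) (_ : Field K) (_ : NumberField K),
        IsImaginaryQuadratic K ∧ 4 < (NumberField.discr K).natAbs ∧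
        SatisfiesHeegnerHypothesis ((⟨0, -21 * (p : ℚ), 0, 112 * (p : ℚ) ^ 2, 0⟩ : WeierstrassCurve ℚ).conductorNorm ℤ) K ∧
        ((⟨0, -21 * (p : ℚ), 0, 112 * (p : ℚ) ^ 2, 0⟩ : WeierstrassCurve ℚ).quadraticTwist (NumberField.discr K : ℚ)).entireLFunction 1 ≠ 0 ∧
        NumberField.classNumber K < p ∧ ¬ p ∣ NumberField.classNumber K :=
  rung255_of_groupOrder hBT X049.groupOrder_A7_holds

/-- ★★ **Rung `615 = 3·5·41`** (`K′ = ℚ(√−615)`, `h = 20`), modulo Burungale–Tian ALONE: for every prime `p ≡ 1 (mod 4)`, `p ≡ 3, 5, 6 (mod 7)`,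
`(−615/p) = +1`, `p > 20`, the conclusion of crux 21381 for `W = X₀(49)^{(−p)} = ⟨0, −21p, 0, 112p², 0⟩`. [cite: BurungaleTian2026, Thm. 1.1] -/
theorem rung615_of_BT (hBT : burungaleTian_analyticRank_eq_zero_of_selmerCorank_eq_zero_of_hasCM) :
    ∀ (p : ℕ) [Fact p.Prime], p % 4 = 1 → (p % 7 = 3 ∨ p % 7 = 5 ∨ p % 7 = 6) → jacobiSym (-615) p = 1 → 20 < p →
      ∃ (K : Type) (_ : Field K) (_ : NumberField K),
        IsImaginaryQuadratic K ∧ 4 < (NumberField.discr K).natAbs ∧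
        SatisfiesHeegnerHypothesis ((⟨0, -21 * (p : ℚ), 0, 112 * (p : ℚ) ^ 2, 0⟩ : WeierstrassCurve ℚ).conductorNorm ℤ) K ∧
        ((⟨0, -21 * (p : ℚ), 0, 112 * (p : ℚ) ^ 2, 0⟩ : WeierstrassCurve ℚ).quadraticTwist (NumberField.discr K : ℚ)).entireLFunction 1 ≠ 0 ∧
        NumberField.classNumber K < p ∧ ¬ p ∣ NumberField.classNumber K :=
  rung615_of_groupOrder hBT X049.groupOrder_A7_holds

/-- ★★ **Rung `663 = 3·13·17`** (`K′ = ℚ(√−663)`, `h = 16`), modulo Burungale–Tian ALONE: for every prime `p ≡ 1 (mod 4)`, `p ≡ 3, 5, 6 (mod 7)`,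
`(−663/p) = +1`, `p > 16`, the conclusion of crux 21381 for `W = X₀(49)^{(−p)} = ⟨0, −21p, 0, 112p², 0⟩`. [cite: BurungaleTian2026, Thm. 1.1] -/
theorem rung663_of_BT (hBT : burungaleTian_analyticRank_eq_zero_of_selmerCorank_eq_zero_of_hasCM) :
    ∀ (p : ℕ) [Fact p.Prime], p % 4 = 1 → (p % 7 = 3 ∨ p % 7 = 5 ∨ p % 7 = 6) → jacobiSym (-663) p = 1 → 16 < p →
      ∃ (K : Type) (_ : Field K) (_ : NumberField K),
        IsImaginaryQuadratic K ∧ 4 < (NumberField.discr K).natAbs ∧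
        SatisfiesHeegnerHypothesis ((⟨0, -21 * (p : ℚ), 0, 112 * (p : ℚ) ^ 2, 0⟩ : WeierstrassCurve ℚ).conductorNorm ℤ) K ∧
        ((⟨0, -21 * (p : ℚ), 0, 112 * (p : ℚ) ^ 2, 0⟩ : WeierstrassCurve ℚ).quadraticTwist (NumberField.discr K : ℚ)).entireLFunction 1 ≠ 0 ∧
        NumberField.classNumber K < p ∧ ¬ p ∣ NumberField.classNumber K :=
  rung663_of_groupOrder hBT X049.groupOrder_A7_holds

/-- ★★ **Rung `1095 = 3·5·73`** (`K′ = ℚ(√−1095)`, `h = 28`), modulo Burungale–Tian ALONE: for every prime `p ≡ 1 (mod 4)`, `p ≡ 3, 5, 6 (mod 7)`,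
`(−1095/p) = +1`, `p > 28`, the conclusion of crux 21381 for `W = X₀(49)^{(−p)} = ⟨0, −21p, 0, 112p², 0⟩`. [cite: BurungaleTian2026, Thm. 1.1] -/
theorem rung1095_of_BT (hBT : burungaleTian_analyticRank_eq_zero_of_selmerCorank_eq_zero_of_hasCM) :
    ∀ (p : ℕ) [Fact p.Prime], p % 4 = 1 → (p % 7 = 3 ∨ p % 7 = 5 ∨ p % 7 = 6) → jacobiSym (-1095) p = 1 → 28 < p →
      ∃ (K : Type) (_ : Field K) (_ : NumberField K),
        IsImaginaryQuadratic K ∧ 4 < (NumberField.discr K).natAbs ∧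
        SatisfiesHeegnerHypothesis ((⟨0, -21 * (p : ℚ), 0, 112 * (p : ℚ) ^ 2, 0⟩ : WeierstrassCurve ℚ).conductorNorm ℤ) K ∧
        ((⟨0, -21 * (p : ℚ), 0, 112 * (p : ℚ) ^ 2, 0⟩ : WeierstrassCurve ℚ).quadraticTwist (NumberField.discr K : ℚ)).entireLFunction 1 ≠ 0 ∧
        NumberField.classNumber K < p ∧ ¬ p ∣ NumberField.classNumber K :=
  rung1095_of_groupOrder hBT X049.groupOrder_A7_holds

/-- ★★ **Rung `1335 = 3·5·89`** (`K′ = ℚ(√−1335)`, `h = 28`), modulo Burungale–Tian ALONE: for every prime `p ≡ 1 (mod 4)`, `p ≡ 3, 5, 6 (mod 7)`,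
`(−1335/p) = +1`, `p > 28`, the conclusion of crux 21381 for `W = X₀(49)^{(−p)} = ⟨0, −21p, 0, 112p², 0⟩`. [cite: BurungaleTian2026, Thm. 1.1] -/
theorem rung1335_of_BT (hBT : burungaleTian_analyticRank_eq_zero_of_selmerCorank_eq_zero_of_hasCM) :
    ∀ (p : ℕ) [Fact p.Prime], p % 4 = 1 → (p % 7 = 3 ∨ p % 7 = 5 ∨ p % 7 = 6) → jacobiSym (-1335) p = 1 → 28 < p →
      ∃ (K : Type) (_ : Field K) (_ : NumberField K),
        IsImaginaryQuadratic K ∧ 4 < (NumberField.discr K).natAbs ∧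
        SatisfiesHeegnerHypothesis ((⟨0, -21 * (p : ℚ), 0, 112 * (p : ℚ) ^ 2, 0⟩ : WeierstrassCurve ℚ).conductorNorm ℤ) K ∧
        ((⟨0, -21 * (p : ℚ), 0, 112 * (p : ℚ) ^ 2, 0⟩ : WeierstrassCurve ℚ).quadraticTwist (NumberField.discr K : ℚ)).entireLFunction 1 ≠ 0 ∧
        NumberField.classNumber K < p ∧ ¬ p ∣ NumberField.classNumber K :=
  rung1335_of_groupOrder hBT X049.groupOrder_A7_holds

/-- ★★ **Rung `1455 = 3·5·97`** (`K′ = ℚ(√−1455)`, `h = 28`), modulo Burungale–Tian ALONE: for every prime `p ≡ 1 (mod 4)`, `p ≡ 3, 5, 6 (mod 7)`,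
`(−1455/p) = +1`, `p > 28`, the conclusion of crux 21381 for `W = X₀(49)^{(−p)} = ⟨0, −21p, 0, 112p², 0⟩`. [cite: BurungaleTian2026, Thm. 1.1] -/
theorem rung1455_of_BT (hBT : burungaleTian_analyticRank_eq_zero_of_selmerCorank_eq_zero_of_hasCM) :
    ∀ (p : ℕ) [Fact p.Prime], p % 4 = 1 → (p % 7 = 3 ∨ p % 7 = 5 ∨ p % 7 = 6) → jacobiSym (-1455) p = 1 → 28 < p →
      ∃ (K : Type) (_ : Field K) (_ : NumberField K),
        IsImaginaryQuadratic K ∧ 4 < (NumberField.discr K).natAbs ∧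
        SatisfiesHeegnerHypothesis ((⟨0, -21 * (p : ℚ), 0, 112 * (p : ℚ) ^ 2, 0⟩ : WeierstrassCurve ℚ).conductorNorm ℤ) K ∧
        ((⟨0, -21 * (p : ℚ), 0, 112 * (p : ℚ) ^ 2, 0⟩ : WeierstrassCurve ℚ).quadraticTwist (NumberField.discr K : ℚ)).entireLFunction 1 ≠ 0 ∧
        NumberField.classNumber K < p ∧ ¬ p ∣ NumberField.classNumber K :=
  rung1455_of_groupOrder hBT X049.groupOrder_A7_holds

/-- ★★ **Rung `1599 = 3·13·41`** (`K′ = ℚ(√−1599)`, `h = 36`), modulo Burungale–Tian ALONE: for every prime `p ≡ 1 (mod 4)`, `p ≡ 3, 5, 6 (mod 7)`,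
`(−1599/p) = +1`, `p > 36`, the conclusion of crux 21381 for `W = X₀(49)^{(−p)} = ⟨0, −21p, 0, 112p², 0⟩`. [cite: BurungaleTian2026, Thm. 1.1] -/
theorem rung1599_of_BT (hBT : burungaleTian_analyticRank_eq_zero_of_selmerCorank_eq_zero_of_hasCM) :
    ∀ (p : ℕ) [Fact p.Prime], p % 4 = 1 → (p % 7 = 3 ∨ p % 7 = 5 ∨ p % 7 = 6) → jacobiSym (-1599) p = 1 → 36 < p →
      ∃ (K : Type) (_ : Field K) (_ : NumberField K),
        IsImaginaryQuadratic K ∧ 4 < (NumberField.discr K).natAbs ∧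
        SatisfiesHeegnerHypothesis ((⟨0, -21 * (p : ℚ), 0, 112 * (p : ℚ) ^ 2, 0⟩ : WeierstrassCurve ℚ).conductorNorm ℤ) K ∧
        ((⟨0, -21 * (p : ℚ), 0, 112 * (p : ℚ) ^ 2, 0⟩ : WeierstrassCurve ℚ).quadraticTwist (NumberField.discr K : ℚ)).entireLFunction 1 ≠ 0 ∧
        NumberField.classNumber K < p ∧ ¬ p ∣ NumberField.classNumber K :=
  rung1599_of_groupOrder hBT X049.groupOrder_A7_holds

/-- ★★ **Rung `1615 = 19·5·17`** (`K′ = ℚ(√−1615)`, `h = 24`), modulo Burungale–Tian ALONE: for every prime `p ≡ 1 (mod 4)`, `p ≡ 3, 5, 6 (mod 7)`,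
`(−1615/p) = +1`, `p > 24`, the conclusion of crux 21381 for `W = X₀(49)^{(−p)} = ⟨0, −21p, 0, 112p², 0⟩`. [cite: BurungaleTian2026, Thm. 1.1] -/
theorem rung1615_of_BT (hBT : burungaleTian_analyticRank_eq_zero_of_selmerCorank_eq_zero_of_hasCM) :
    ∀ (p : ℕ) [Fact p.Prime], p % 4 = 1 → (p % 7 = 3 ∨ p % 7 = 5 ∨ p % 7 = 6) → jacobiSym (-1615) p = 1 → 24 < p →
      ∃ (K : Type) (_ : Field K) (_ : NumberField K),
        IsImaginaryQuadratic K ∧ 4 < (NumberField.discr K).natAbs ∧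
        SatisfiesHeegnerHypothesis ((⟨0, -21 * (p : ℚ), 0, 112 * (p : ℚ) ^ 2, 0⟩ : WeierstrassCurve ℚ).conductorNorm ℤ) K ∧
        ((⟨0, -21 * (p : ℚ), 0, 112 * (p : ℚ) ^ 2, 0⟩ : WeierstrassCurve ℚ).quadraticTwist (NumberField.discr K : ℚ)).entireLFunction 1 ≠ 0 ∧
        NumberField.classNumber K < p ∧ ¬ p ∣ NumberField.classNumber K :=
  rung1615_of_groupOrder hBT X049.groupOrder_A7_holds

end Summit.BirchSwinnertonDyer.BirchSwinnertonDyer.Theorems.BiquadraticEisensteinDescentHeegnerTwistCouplingInSupplySqrtSevenCornerBT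

end
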